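import Literature.AnabelianGeometry.AbsoluteAnabelian.AbsTopII.InertiaGroupsBranchScope
import Literature.AnabelianGeometry.AbsoluteAnabelian.AbsTopII.DecompositionGroupsMoreover
import Literature.AnabelianGeometry.AbsoluteAnabelian.AbsTopII.Prop13SmoothCurveModel

/-!
# [AbsTopII] Prop 1.3: the NODE clauses ((ii), (ii′)) and the (iv) «Moreover» clauses are IDLE at smooth-curve shape

S. Mochizuki, *Topics in Absolute Anabelian Geometry II* [AbsTopII] (bib `MochizukiAbsTopII2013`;
locators = PDF pages of the kurims manuscript `paper:url-585b8d0ad0d9`), §1, Prop 1.3 (ii) p. 11 ("If `e`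
is a node of `𝔾`, then …") and (iv) pp. 11–12 («Moreover, in the situation of (2) …; of (3) …» — the
situations with two DISTINCT vertices).

PROOF-ONLY bookkeeping (no definition), abc-iut-L4-t6 lineage (typer of record of `Prop_1_3_ii` p405221 and
of the «Moreover» typing `DPSCData.Prop13iv_moreover` p431316; `Prop_1_3_ii'` is abc-iut-w5-d102's v2).
abc-iut-f-069's constructed-model coverage census (13:11Z) lists (ii)/(ii′) and (iv) «Moreover» among the
clauses with no closer at constructed data.  At data of SMOOTH-CURVE SHAPE — NO node, ONE vertex — these
clauses quantify over nodes, resp. over pairs of distinct vertices, hence hold VACUOUSLY; this file records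
that honestly (so the coverage table has an entry, explicitly labelled IDLE, not a discharge):

* `prop_1_3_ii_of_isEmpty_node`, `prop_1_3_ii'_of_isEmpty_node` — (ii) v1/v2 at node-free data;
* `DPSCData.prop13iv_moreover_of_subsingleton_vert` — the (iv) «Moreover» clauses at one-vertex data;
* `exists_smoothCurve_model_prop_1_3_ii'_and_iv_moreover` — hence at abc-iut-f-066's smooth-curve model
  (`exists_smoothCurve_product_model`, p446583), for the record.
A model WITH A NODE (degenerating shape: two vertex groups amalgamated along `Ẑ^Σ(1)`, or a loop) is what a
NON-idle instance of (ii′) / (iv) «Moreover» requires — not in the tree.  HONEST FRAMING: vacuous instances,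
labelled as such; typed ≠ proved; nothing here bears on [IUTchIII] Cor 3.12.
-/

universe u

namespace Literature.AnabelianGeometry.AbsoluteAnabelian

open Literature.GroupTheory.CombinatorialGroupTheory

/-- The (iv) «Moreover» clauses (situations (2), (3): two DISTINCT vertices) are IDLE at one-vertex data.
[cite: MochizukiAbsTopII2013, Prop 1.3 (iv) p.12] -/
theorem DPSCData.prop13iv_moreover_of_subsingleton_vert (X : DPSCData.{u}) (hV : ∀ v w : X.Vert, v = w) :
    X.Prop13iv_moreover :=
  ⟨fun v v' _ hne _ _ => absurd (hV v v') hne, fun v v' _ hne _ _ _ _ _ => absurd (hV v v') hne⟩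

namespace AbsTopII.DPSCIndexData

/-- Prop 1.3 (ii) (v1 typing) is IDLE at node-free data. [cite: MochizukiAbsTopII2013, Prop 1.3 (ii) p.11] -/
theorem prop_1_3_ii_of_isEmpty_node (X : DPSCIndexData.{u}) [IsEmpty X.Node] : X.Prop_1_3_ii :=
  fun e => isEmptyElim e

/-- Prop 1.3 (ii′) (v2 typing, branch reading) is IDLE at node-free data. [cite: MochizukiAbsTopII2013, Prop 1.3 (ii) p.11] -/
theorem prop_1_3_ii'_of_isEmpty_node (X : DPSCIndexData.{u}) [IsEmpty X.Node] : X.Prop_1_3_ii' :=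
  fun e => isEmptyElim e

/-- For the record: at abc-iut-f-066's smooth-curve model WITH CUSPS (no node, one vertex) the typed (ii′)
and the (iv) «Moreover» clauses hold — IDLY (there is no node and no second vertex); a non-idle instance
needs a model with a node. [cite: MochizukiAbsTopII2013, Prop 1.3 (ii) p.11] -/
theorem exists_smoothCurve_model_prop_1_3_ii'_and_iv_moreover (Sigma : Set ℕ) (hS₁ : Sigma.Nonempty)
    (hS₂ : ∀ p ∈ Sigma, p.Prime) (g r : ℕ) (hgr : PuncturedSurfaceGroup.IsHyperbolicType g r)
    (hr : 0 < r) :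
    ∃ X : DPSCIndexData.{0}, X.Sigma = Sigma ∧ Nonempty (X.Cusp ≃ Fin r) ∧ IsEmpty X.Node ∧
      (∀ v w : X.Vert, v = w) ∧
      Literature.AnabelianGeometry.AbsoluteAnabelian.AbsTopII.DPSCIndexData.Prop_1_3_ii' X ∧
      X.toDPSCData.Prop13iv_moreover := by
  obtain ⟨Q, ι₀, hι₀, Z, hZ, G, hιr, hιn, X, -, -, -, -, -, -, -, -, -, -, -, -, -, hXS, -, hXc, hXn,
    -, hV, -⟩ := exists_smoothCurve_product_model Sigma hS₁ hS₂ g r hgr hr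
  haveI := hXn
  exact ⟨X, hXS, hXc, hXn, hV, X.prop_1_3_ii'_of_isEmpty_node,
    X.toDPSCData.prop13iv_moreover_of_subsingleton_vert hV⟩

end AbsTopII.DPSCIndexData

end Literature.AnabelianGeometry.AbsoluteAnabelian
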